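import Mathlib
import Summits.KontsevichZagierPeriods.Zeta5Search.Certificates.RecordRayPhatData
import Summits.KontsevichZagierPeriods.Zeta5Search.Certificates.RecordRayConeForms
import Summits.KontsevichZagierPeriods.Zeta5Search.Certificates.RecordRayPgenDegree
import HarnessLib

/-! # Record ray, (N) for every `n ≥ 1` — F. identification of `Pgen` from the 356 point checks (S4-R1 item #10, step N-2c)

Under the window hypothesis `H : ∀ j < 356, IdP j` (discharged in `RecordRayIdentWindow`; kept as a hypothesis here so that
this file elaborates in seconds): `Pgen X = c0 • Ĝ(X) • P̂(X)` in `M₃(ℤ[X])` — both sides have entries of degree `≤ 355`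
(`RecordRayPgenDegree.natDegree_Pgen_le`, `natDegree_rhsMat_le`) and agree at the 356 integers `−177 … 178`
(`Polynomial.eq_of_natDegree_lt_card_of_eval_eq`) — and, by naturality of both sides under `ℤ[X] → R`, for every commutative
ring `R` and every `ν : R`: `Pgen ν = (c0 · Ĝ(ν)) • P̂(ν)` (`Pgen_eq_smul`, the form the cone induction consumes at `ν = n`).

Provenance: gen-2 g32's kernel-checked scratch `AllN_G15.lean` (2026-08-22, rc 0 / 0 sorry, axioms propext ·
Classical.choice · Quot.sound), built on fam-tele g15's generic record-ray interface (`RecordRayGenericForms/Steps`,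
`RecordRayMirror`, `RecordRayRaySteps`, `RecordRayChain`, all in the tree); data from gen-2 g31 (`P̂`, align) and fam-tele
g14 (`conn/PATH.md`).  Staged for the tree by gen-2 g33 (S4-R1 item #10); `deg_le` replaced by `apply_rules` (gen-2 g34);
the two `hornerG` unfolding lemmas are taken from `RecordRayConeForms` (gate dedup, P1 g15); gate-lint pass (macros expanded, no metaprogramming) by gen-2 g34.

HONEST FRAMING: systematic search; no irrationality claim unless certified; this is clause (N) of Brown–Zudilin's Theorem 1
(arXiv:2210.03391) for THEIR OWN record cell — the non-vanishing of their linear forms — and nothing about ζ(5) beyond that;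
records UNMOVED. -/

namespace Summit.KontsevichZagierPeriods.Zeta5Search.RecordRay.Generic

open Polynomial Matrix

section Identify
variable {R S : Type*} [CommRing R] [CommRing S]

/-! #### F.1 The data side: unfolding, naturality, degrees -/

-- `hornerG_nil'` / `hornerG_cons'` (the definitional unfoldings of `hornerG`) are imported from `RecordRayConeForms`.

/-- Naturality of `hornerG` under ring homomorphisms. -/
theorem map_hornerG (f : R →+* S) (cs : List ℤ) (ν : R) : f (hornerG cs ν) = hornerG cs (f ν) := by
  induction cs with
  | nil => rw [hornerG_nil', hornerG_nil', map_zero]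
  | cons c cs ih => rw [hornerG_cons', hornerG_cons', map_add, map_mul, map_intCast, ih]

/-- Naturality of the factored product `∏ (d ν − m)^e` under ring homomorphisms. -/
theorem map_facFoldr (f : R →+* S) (L : List (ℤ × ℤ × ℕ)) (ν : R) :
    f (L.foldr (fun (t : ℤ × ℤ × ℕ) (acc : R) => ((t.1 : R) * ν - (t.2.1 : R)) ^ t.2.2 * acc) 1)
      = L.foldr (fun (t : ℤ × ℤ × ℕ) (acc : S) => ((t.1 : S) * f ν - (t.2.1 : S)) ^ t.2.2 * acc) 1 := by
  induction L with
  | nil => simp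
  | cons t L ih => rw [List.foldr_cons, List.foldr_cons, map_mul, map_pow, map_sub, map_mul, map_intCast, map_intCast, ih]

/-- Naturality of `Ĝ` under ring homomorphisms. -/
theorem map_ghatG (f : R →+* S) (ν : R) : f (ghatG ν) = ghatG (f ν) := map_facFoldr f ghatFac ν

/-- Naturality of `P̂` under ring homomorphisms. -/
theorem map_phatG (f : R →+* S) (ν : R) : f.mapMatrix (phatG ν).toMatrix = (phatG (f ν)).toMatrix := by
  ext i j; fin_cases i <;> fin_cases j <;> simp [phatG, M3.toMatrix, map_hornerG]

/-- Naturality of `c0 • Ĝ • P̂` under ring homomorphisms. -/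
theorem map_rhsMat (f : R →+* S) (ν : R) : f.mapMatrix (rhsMat ν) = rhsMat (f ν) := by
  ext i j
  have hP := congrFun (congrFun (map_phatG f ν) i) j
  simp only [RingHom.mapMatrix_apply, Matrix.map_apply] at hP
  simp only [rhsMat, RingHom.mapMatrix_apply, Matrix.map_apply, Matrix.smul_apply, smul_eq_mul, map_mul,
    map_intCast, map_ghatG, hP]

/-- `toMatrix (M3.smul c A) = c • toMatrix A`. -/
theorem M3.toMatrix_smul (c : R) (A : M3 R) : (M3.smul c A).toMatrix = c • A.toMatrix := by
  ext i j; fin_cases i <;> fin_cases j <;> simp [M3.smul, M3.toMatrix]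

/-- One kernel point check, read as a `Matrix` identity over `ℤ`. -/
theorem Pgen_eq_rhsMat_of_identAt {k : ℤ} (h : identAt k = true) : Pgen k = rhsMat k := by
  have h' := (M3.beq_iff _ _).1 h
  rw [← toMatrix_PgenM, h', M3.toMatrix_smul, rhsMat, Int.cast_id]

/-- `natDegree (hornerG (c :: cs) X) ≤ cs.length`. -/
theorem natDegree_hornerG_cons_le (cs : List ℤ) :
    ∀ c : ℤ, (hornerG (c :: cs) (X : R[X])).natDegree ≤ cs.length := by
  induction cs with
  | nil =>
    intro c
    rw [hornerG_cons', hornerG_nil', mul_zero, add_zero, List.length_nil]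
    exact (natDegree_intCast _).le
  | cons c' cs ih =>
    intro c
    rw [hornerG_cons', List.length_cons]
    exact (nd_add (nd_intCast _) (nd_mul nd_X (ih c'))).trans (by omega)

/-- The degree of `∏ (d X − m)^e` is at most the sum of the exponents. -/
theorem natDegree_facFoldr_le (L : List (ℤ × ℤ × ℕ)) :
    (L.foldr (fun (t : ℤ × ℤ × ℕ) (acc : R[X]) => ((t.1 : R[X]) * X - (t.2.1 : R[X])) ^ t.2.2 * acc) 1).natDegree
      ≤ (L.map (fun t => t.2.2)).sum := by
  induction L with
  | nil => simp
  | cons t L ih =>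
    rw [List.foldr_cons, List.map_cons, List.sum_cons]
    have h1 : (((t.1 : R[X]) * X - (t.2.1 : R[X]))).natDegree ≤ 1 :=
      (nd_sub (nd_mul (nd_intCast _) nd_X) (nd_intCast _)).trans (by omega)
    exact (nd_mul (nd_pow _ h1) ih).trans (by omega)

/-- `natDegree Ĝ(X) ≤ 277`. -/
theorem natDegree_ghatG_le : (ghatG (X : R[X])).natDegree ≤ 277 :=
  (natDegree_facFoldr_le ghatFac).trans (by decide +kernel)

/-- `natDegree (hornerG ph00 X) ≤ 78`. -/
theorem natDegree_ph00_le : (hornerG ph00 (X : R[X])).natDegree ≤ 78 := by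
  unfold ph00; exact (natDegree_hornerG_cons_le _ _).trans (by decide)
/-- `natDegree (hornerG ph01 X) ≤ 78`. -/
theorem natDegree_ph01_le : (hornerG ph01 (X : R[X])).natDegree ≤ 78 := by
  unfold ph01; exact (natDegree_hornerG_cons_le _ _).trans (by decide)
/-- `natDegree (hornerG ph02 X) ≤ 78`. -/
theorem natDegree_ph02_le : (hornerG ph02 (X : R[X])).natDegree ≤ 78 := by
  unfold ph02; exact (natDegree_hornerG_cons_le _ _).trans (by decide)
/-- `natDegree (hornerG ph10 X) ≤ 78`. -/
theorem natDegree_ph10_le : (hornerG ph10 (X : R[X])).natDegree ≤ 78 := by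
  unfold ph10; exact (natDegree_hornerG_cons_le _ _).trans (by decide)
/-- `natDegree (hornerG ph11 X) ≤ 78`. -/
theorem natDegree_ph11_le : (hornerG ph11 (X : R[X])).natDegree ≤ 78 := by
  unfold ph11; exact (natDegree_hornerG_cons_le _ _).trans (by decide)
/-- `natDegree (hornerG ph12 X) ≤ 78`. -/
theorem natDegree_ph12_le : (hornerG ph12 (X : R[X])).natDegree ≤ 78 := by
  unfold ph12; exact (natDegree_hornerG_cons_le _ _).trans (by decide)
/-- `natDegree (hornerG ph20 X) ≤ 78`. -/
theorem natDegree_ph20_le : (hornerG ph20 (X : R[X])).natDegree ≤ 78 := by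
  unfold ph20; exact (natDegree_hornerG_cons_le _ _).trans (by decide)
/-- `natDegree (hornerG ph21 X) ≤ 78`. -/
theorem natDegree_ph21_le : (hornerG ph21 (X : R[X])).natDegree ≤ 78 := by
  unfold ph21; exact (natDegree_hornerG_cons_le _ _).trans (by decide)
/-- `natDegree (hornerG ph22 X) ≤ 78`. -/
theorem natDegree_ph22_le : (hornerG ph22 (X : R[X])).natDegree ≤ 78 := by
  unfold ph22; exact (natDegree_hornerG_cons_le _ _).trans (by decide)

/-- Every entry of `P̂(X)` has degree `≤ 78`. -/
theorem natDegree_phatG_le (i j : Fin 3) : ((phatG (X : R[X])).toMatrix i j).natDegree ≤ 78 := by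
  fin_cases i <;> fin_cases j <;>
    simp [phatG, M3.toMatrix, natDegree_ph00_le, natDegree_ph01_le, natDegree_ph02_le, natDegree_ph10_le,
      natDegree_ph11_le, natDegree_ph12_le, natDegree_ph20_le, natDegree_ph21_le, natDegree_ph22_le]

/-- Every entry of `c0 • Ĝ(X) • P̂(X)` has degree `≤ 355`. -/
theorem natDegree_rhsMat_le (i j : Fin 3) : (rhsMat (X : R[X]) i j).natDegree ≤ 355 := by
  have h1 := natDegree_ghatG_le (R := R)
  have h2 := natDegree_phatG_le (R := R) i j
  unfold rhsMat
  rw [Matrix.smul_apply, smul_eq_mul]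
  exact le_trans (by apply_rules (maxDepth := 9999) (transparency := .reducible) only [*, nd_add, nd_sub, nd_mul,
    nd_neg, nd_pow, nd_X, nd_one, nd_zero, nd_ofNat, nd_intCast, nd_natCast]) (by decide)

/-! #### F.2 Lagrange over `ℤ[X]` and transfer to every ring -/

omit [CommRing R] in
/-- Reading an entry of a mapped matrix identity as an evaluation. -/
theorem eval_entry (t : ℤ) (M : ℤ → Matrix (Fin 3) (Fin 3) ℤ) (MX : Matrix (Fin 3) (Fin 3) ℤ[X])
    (hmap : (evalRingHom t).mapMatrix MX = M t) (i j : Fin 3) : eval t (MX i j) = M t i j := by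
  have := congrFun (congrFun hmap i) j
  simpa [RingHom.mapMatrix_apply, Matrix.map_apply] using this

/-- **Step N-2c, entrywise.** The 356 point checks identify each entry of the integer period matrix. -/
theorem Pgen_X_entry_eq (H : ∀ j : ℕ, j < 356 → IdP j = true) (i j : Fin 3) : Pgen (X : ℤ[X]) i j = rhsMat (X : ℤ[X]) i j := by
  have hf : Function.Injective (fun k : Fin 356 => ((k : ℕ) : ℤ) - 177) := by
    intro a b hab
    have h' : ((a : ℕ) : ℤ) - 177 = ((b : ℕ) : ℤ) - 177 := hab
    exact Fin.ext (by omega)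
  have heval : ∀ k : Fin 356,
      eval (((k : ℕ) : ℤ) - 177) (Pgen (X : ℤ[X]) i j) = eval (((k : ℕ) : ℤ) - 177) (rhsMat (X : ℤ[X]) i j) := by
    intro k
    have hk : Pgen ((((k : ℕ) : ℤ) - 177)) = rhsMat ((((k : ℕ) : ℤ) - 177)) := Pgen_eq_rhsMat_of_identAt (H k k.isLt)
    have e1 := eval_entry (((k : ℕ) : ℤ) - 177) Pgen (Pgen X) (by rw [map_Pgen]; simp) i j
    have e2 := eval_entry (((k : ℕ) : ℤ) - 177) rhsMat (rhsMat X) (by rw [map_rhsMat]; simp) i j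
    rw [e1, e2, hk]
  have hcard : max (Pgen (X : ℤ[X]) i j).natDegree (rhsMat (X : ℤ[X]) i j).natDegree < Fintype.card (Fin 356) := by
    have h1 := natDegree_Pgen_le (R := ℤ) i j
    have h2 := natDegree_rhsMat_le (R := ℤ) i j
    simp only [Fintype.card_fin]
    omega
  exact Polynomial.eq_of_natDegree_lt_card_of_eval_eq _ _ hf heval hcard

/-- **Step N-2c.** `Pgen X = c0 • Ĝ(X) • P̂(X)` in `M₃(ℤ[X])`. -/
theorem Pgen_X_eq_rhsMat (H : ∀ j : ℕ, j < 356 → IdP j = true) : Pgen (X : ℤ[X]) = rhsMat (X : ℤ[X]) :=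
  Matrix.ext fun i j => Pgen_X_entry_eq H i j

/-- **Identification for every commutative ring** (the form step N-3 consumes, e.g. at `ν = (n : ℚ)`):
`Pgen ν = (c0 · Ĝ(ν)) • P̂(ν)`. -/
theorem Pgen_eq_rhsMat (H : ∀ j : ℕ, j < 356 → IdP j = true) (ν : R) : Pgen ν = rhsMat ν := by
  have hZ := congrArg (Polynomial.eval₂RingHom (Int.castRingHom R) ν).mapMatrix (Pgen_X_eq_rhsMat H)
  rw [map_Pgen, map_rhsMat] at hZ
  simpa using hZ

/-- **Identification, smul form:** under the 356 point identities, `Pgen ν = (c0 · Ĝ(ν)) • P̂(ν)` for every commutative ring and every `ν`. -/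
theorem Pgen_eq_smul (H : ∀ j : ℕ, j < 356 → IdP j = true) (ν : R) : Pgen ν = ((c0 : R) * ghatG ν) • (phatG ν).toMatrix :=
  Pgen_eq_rhsMat H ν

end Identify

end Summit.KontsevichZagierPeriods.Zeta5Search.RecordRay.Generic
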